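import Mathlib
import HarnessLib
import Summits.HubbardSuperconductivity.HubbardSuperconductivity.Theorems.KLProgrammeKLRegimeTwoPointLimitCooperResummationLipschitz
import Summits.HubbardSuperconductivity.HubbardSuperconductivity.Theorems.KLProgrammeKLRegimeTwoPointLimitCooperResummationOffdiag

/-!
# Route `KLProgramme`, crux K3 (stmt-HubbardSuperconductivity-19937), child 1 — WEIGHTED Lipschitz bound for the resummation map
# (`klcrf_lipschitz_weighted`; cell gate-hubbard-kl, seat p1 = C1 lead, g5)

Sequel to `…CooperResummationLipschitz` (max-entry Lipschitz, constant 36) and `…Offdiag`.  With `F_w(X) = (1 + X·diag w)⁻¹·X`,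
`Xᵢ = u·J + 𝒟ᵢ`, `|𝒟ᵢ| ≤ δ`, `W·δ ≤ 1/3`, `E = 𝒟₁ − 𝒟₂`, the exact identity `F_w(X₁) − F_w(X₂) = P·E·R` (`klcrf_resolvent_identity`) with
`P = (1 + X₁ diag w)⁻¹ = 1 + (weight-small)` (`klcrf_inv_entry_sub_delta_le`) and `R = 1 − diag w·F_w(X₂) = 1 + (weight-small)` (`klcrf_structure`)
gives the ENTRYWISE bound
  `|(F_w(X₁) − F_w(X₂))(a,b)| ≤ |E(a,b)| + g·Σ_s w_s|E(s,b)| + f·Σ_t w_t·(|E(a,t)| + g·Σ_s w_s|E(s,t)|)`,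
  `f = cascadeStep W u + 12δ`, `g = (3/2)δ + (9/2)/W`:
a perturbation localised on a few rows/columns moves the OTHER entries only in proportion to the weights of those rows/columns.  This is the
form child 1 needs to propagate the entry-localised leg-dressing remainder of `PairLadderStepAtV4` at total cost `O(U²)` (HOME/p1/CHILD1-SKELETON.md
§4 (v)).  Pure finite-dimensional linear algebra.
-/

noncomputable section

namespace Summit.HubbardSuperconductivity.HubbardSuperconductivity.Theorems.KLProgrammeCooperResummation

set_option linter.dupNamespace false -- summit = problem name (single-conjunct summit), D-0017

open scoped Matrix.Norms.Operator
open Matrix Finset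
open Summit.HubbardSuperconductivity.HubbardSuperconductivity.Theorems.CooperChannelRiccatiFlow

variable {S : Type*} [Fintype S] [DecidableEq S] [Nonempty S]

/-- **Weighted Lipschitz bound.**  For `w ≥ 0`, `W = Σ w`, `u ≥ 0`, `|𝒟₁|, |𝒟₂| ≤ δ`, `W·δ ≤ 1/3`, with `E = 𝒟₁ − 𝒟₂`,
`f = cascadeStep W u + 12δ` and `g = (3/2)δ + (9/2)/W`:
`|(F_w(uJ+𝒟₁) − F_w(uJ+𝒟₂))(a,b)| ≤ |E(a,b)| + g Σ_s w_s|E(s,b)| + f Σ_t w_t (|E(a,t)| + g Σ_s w_s |E(s,t)|)`. -/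
theorem klcrf_lipschitz_weighted (w : S → ℝ) (hw : ∀ s, 0 ≤ w s) {u δ : ℝ} (hu : 0 ≤ u) (hδ : 0 ≤ δ)
    (𝒟₁ 𝒟₂ : Matrix S S ℂ) (h𝒟₁ : ∀ s t, ‖𝒟₁ s t‖ ≤ δ) (h𝒟₂ : ∀ s t, ‖𝒟₂ s t‖ ≤ δ)
    (hθ : (∑ s, w s) * δ ≤ 1 / 3) (a b : S) :
    ‖((1 + (Matrix.of (fun _ _ : S => (u : ℂ)) + 𝒟₁) * Matrix.diagonal (fun s => (w s : ℂ)))⁻¹ *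
          (Matrix.of (fun _ _ : S => (u : ℂ)) + 𝒟₁) -
        (1 + (Matrix.of (fun _ _ : S => (u : ℂ)) + 𝒟₂) * Matrix.diagonal (fun s => (w s : ℂ)))⁻¹ *
          (Matrix.of (fun _ _ : S => (u : ℂ)) + 𝒟₂)) a b‖ ≤
      ‖(𝒟₁ - 𝒟₂) a b‖ + (3 / 2 * δ + 9 / 2 / ∑ s, w s) * ∑ s, w s * ‖(𝒟₁ - 𝒟₂) s b‖ +
        (cascadeStep (∑ s, w s) u + 12 * δ) *
          ∑ t, w t * (‖(𝒟₁ - 𝒟₂) a t‖ + (3 / 2 * δ + 9 / 2 / ∑ s, w s) * ∑ s, w s * ‖(𝒟₁ - 𝒟₂) s t‖) := by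
  set W : ℝ := ∑ s, w s with hW_def
  have hW : 0 ≤ W := sum_nonneg fun s _ => hw s
  set D : Matrix S S ℂ := Matrix.diagonal (fun s => (w s : ℂ)) with hD_def
  set J : Matrix S S ℂ := Matrix.of (fun _ _ : S => (u : ℂ)) with hJ_def
  set X₁ : Matrix S S ℂ := J + 𝒟₁ with hX₁_def
  set X₂ : Matrix S S ℂ := J + 𝒟₂ with hX₂_def
  set E : Matrix S S ℂ := 𝒟₁ - 𝒟₂ with hE_def
  set g : ℝ := 3 / 2 * δ + 9 / 2 / W with hg_def
  set f : ℝ := cascadeStep W u + 12 * δ with hf_def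
  have hg : 0 ≤ g := by rw [hg_def]; positivity
  have hcs : 0 ≤ cascadeStep W u := by
    unfold cascadeStep; exact div_nonneg hu (by nlinarith [mul_nonneg hW hu])
  have hf : 0 ≤ f := by rw [hf_def]; positivity
  -- the two structure packages
  obtain ⟨hU₁, -, -⟩ := klcrf_structure w hw hu hδ 𝒟₁ h𝒟₁ hθ
  obtain ⟨hU₂, -, hF₂⟩ := klcrf_structure w hw hu hδ 𝒟₂ h𝒟₂ hθ
  have hXE : X₁ - X₂ = E := by rw [hX₁_def, hX₂_def, hE_def]; abel
  -- resolvent identity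
  have hres := klcrf_resolvent_identity X₁ X₂ D hU₁ hU₂
  rw [hXE] at hres
  rw [hres]
  set P : Matrix S S ℂ := (1 + X₁ * D)⁻¹ with hP_def
  set R : Matrix S S ℂ := 1 - D * ((1 + X₂ * D)⁻¹ * X₂) with hR_def
  -- entry bounds for `P` and `R`
  have hP : ∀ s, ‖P a s‖ ≤ (if a = s then 1 else 0) + g * w s := by
    intro s
    have h1 := klcrf_inv_entry_sub_delta_le w hw hu hδ 𝒟₁ h𝒟₁ hθ a s
    have h2 : P a s = (1 : Matrix S S ℂ) a s + (P - 1) a s := by simp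
    rw [h2]
    refine (norm_add_le _ _).trans (add_le_add ?_ ?_)
    · by_cases has : a = s
      · subst has; simp
      · simp [Matrix.one_apply_ne has, has]
    · rw [hP_def, hX₁_def, hJ_def, hD_def]
      calc _ ≤ w s * (3 / 2 * δ + 9 / 2 / ∑ s, w s) := h1
        _ = g * w s := by rw [hg_def, hW_def]; ring
  have hR : ∀ t, ‖R t b‖ ≤ (if t = b then 1 else 0) + f * w t := by
    intro t
    have hF : ‖((1 + X₂ * D)⁻¹ * X₂) t b‖ ≤ f := by
      have h1 : ‖((1 + X₂ * D)⁻¹ * X₂) t b - (cascadeStep W u : ℝ)‖ ≤ 12 * δ := hF₂ t b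
      have h2 : ‖((1 + X₂ * D)⁻¹ * X₂) t b‖ ≤
          ‖((1 + X₂ * D)⁻¹ * X₂) t b - (cascadeStep W u : ℝ)‖ + ‖((cascadeStep W u : ℝ) : ℂ)‖ := by
        have := norm_add_le (((1 + X₂ * D)⁻¹ * X₂) t b - (cascadeStep W u : ℝ)) ((cascadeStep W u : ℝ) : ℂ)
        simpa using this
      rw [Complex.norm_real, Real.norm_eq_abs, abs_of_nonneg hcs] at h2
      rw [hf_def]; linarith
    have hRt : R t b = (1 : Matrix S S ℂ) t b - (w t : ℂ) * ((1 + X₂ * D)⁻¹ * X₂) t b := by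
      rw [hR_def, Matrix.sub_apply, hD_def, Matrix.diagonal_mul]
    rw [hRt]
    refine (norm_sub_le _ _).trans (add_le_add ?_ ?_)
    · by_cases htb : t = b
      · subst htb; simp
      · simp [Matrix.one_apply_ne htb, htb]
    · rw [norm_mul, Complex.norm_real, Real.norm_eq_abs, abs_of_nonneg (hw t), mul_comm]
      exact mul_le_mul_of_nonneg_right hF (hw t)
  -- expand the entry of the triple product and bound termwise
  have hentry : (P * E * R) a b = ∑ t, (∑ s, P a s * E s t) * R t b := by
    simp only [Matrix.mul_apply]
  rw [hentry]
  have hinner : ∀ t, ‖∑ s, P a s * E s t‖ ≤ ‖E a t‖ + g * ∑ s, w s * ‖E s t‖ := by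
    intro t
    calc ‖∑ s, P a s * E s t‖ ≤ ∑ s, ‖P a s * E s t‖ := norm_sum_le _ _
      _ ≤ ∑ s, ((if a = s then 1 else 0) + g * w s) * ‖E s t‖ := sum_le_sum fun s _ => by
          rw [norm_mul]; exact mul_le_mul_of_nonneg_right (hP s) (norm_nonneg _)
      _ = ∑ s, (if a = s then 1 else 0) * ‖E s t‖ + ∑ s, g * w s * ‖E s t‖ := by
          rw [← sum_add_distrib]; exact sum_congr rfl fun s _ => by ring
      _ = ‖E a t‖ + g * ∑ s, w s * ‖E s t‖ := by
          congr 1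
          · simp only [boole_mul, Finset.sum_ite_eq, Finset.mem_univ, if_true]
          · rw [Finset.mul_sum]; exact sum_congr rfl fun s _ => by ring
  have hinner_nonneg : ∀ t, 0 ≤ ‖E a t‖ + g * ∑ s, w s * ‖E s t‖ := fun t =>
    add_nonneg (norm_nonneg _) (mul_nonneg hg (sum_nonneg fun s _ => mul_nonneg (hw s) (norm_nonneg _)))
  calc ‖∑ t, (∑ s, P a s * E s t) * R t b‖ ≤ ∑ t, ‖(∑ s, P a s * E s t) * R t b‖ := norm_sum_le _ _
    _ ≤ ∑ t, (‖E a t‖ + g * ∑ s, w s * ‖E s t‖) * ((if t = b then 1 else 0) + f * w t) := sum_le_sum fun t _ => by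
        rw [norm_mul]; exact mul_le_mul (hinner t) (hR t) (norm_nonneg _) (hinner_nonneg t)
    _ = ∑ t, (if t = b then 1 else 0) * (‖E a t‖ + g * ∑ s, w s * ‖E s t‖) +
          ∑ t, f * (w t * (‖E a t‖ + g * ∑ s, w s * ‖E s t‖)) := by
        rw [← sum_add_distrib]; exact sum_congr rfl fun t _ => by ring
    _ = (‖E a b‖ + g * ∑ s, w s * ‖E s b‖) + f * ∑ t, w t * (‖E a t‖ + g * ∑ s, w s * ‖E s t‖) := by
        congr 1
        · simp only [boole_mul, Finset.sum_ite_eq', Finset.mem_univ, if_true]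
        · rw [Finset.mul_sum]
    _ = _ := by rw [hE_def, hg_def, hf_def, hW_def]

end Summit.HubbardSuperconductivity.HubbardSuperconductivity.Theorems.KLProgrammeCooperResummation

end
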